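import Mathlib.RingTheory.DedekindDomain.Dvr
import Literature.NumberTheory.NumberFields.DyadicUnitSquaresRamifiedPrime
import Literature.NumberTheory.NumberFields.DyadicUnitNotNormFromSqrtTwo
import HarnessLib

/-!
# Dyadic non-norm certificates at a prime IDEAL (principal or not): `ε ≡ ±3 (mod 𝔭³)` at `e = f = 1` is not
# `x² − 2y²`; `ε ≡ 1 (mod 𝔭⁴)`, `≢ 1 (mod 𝔭⁵)` at `e = 2`, `f = 1` is not `x² − θy²` (`𝔭 ‖ θ`) — by localisation at `𝔭`

Topic `NumberTheory/NumberFields` (namespace = path).  THEOREM-ONLY file (no definition, no named fact, no instance, no `sorry`).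
The tree's two elementary dyadic Hilbert-symbol lemmas — `DyadicUnitNotNormFromSqrtTwo.lean` (`2 = πw`, `π ∤ w`, `R/(π) = {0,1}`:
`ε ≡ ±3 (mod π³)` ⟹ `ε ≠ (a² − 2b²)/c²`) and `DyadicUnitSquaresRamifiedPrime.lean` (`2 = π²w`: `π⁴ ‖ ε − 1` ⟹ `ε ≠ (a² − πμ b²)/c²`,
`π ∤ μ`) — ask for a PRIME ELEMENT `π`, i.e. a PRINCIPAL dyadic prime.  The consumers (unit-norm-index certificates for Chevalley's
doors in the cyclotomic `ℤ₂`-tower of a cubic field and of its first layer `F(√2)`, files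
`IwasawaTheory/ClassicalMuVanishesUnitNormIndexTwoNonNormUnits.lean`, `…AnyPrime.lean`) meet NON-principal dyadic primes as soon as
the `2`-class group is non-trivial — exactly the `e_n`-tolerant situation.  This file removes the principality: for a Dedekind domain
`R` and a maximal ideal `𝔭 ≠ 0` with residue field `𝔽₂` (`∀ r, r ∈ 𝔭 ∨ r − 1 ∈ 𝔭`), the hypotheses and the conclusion are transported
to the localisation `R_𝔭` — a discrete valuation ring (Mathlib `IsLocalization.AtPrime.isDiscreteValuationRing_of_dedekind_domain`)
whose uniformiser `ϖ` IS a prime element, with `r ∈ 𝔭ⁿ ⟺ ϖⁿ ∣ r` (Mathlib `IsLocalization.AtPrime.under_maximalIdeal_pow`) — where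
the tree lemmas apply verbatim; an identity `a² − m b² = c²ε` in `R` (or `x² − m y² = ε` in the fraction field) maps to `R_𝔭`.

* `forall_mem_or_sub_one_mem_of_card_quotient_eq_two` — `#(R/𝔭) = 2` ⟹ `∀ r, r ∈ 𝔭 ∨ r − 1 ∈ 𝔭` (the `f = 1` hypothesis in use).
* `e = 1` (`2 ∈ 𝔭 ∖ 𝔭²`): `not_exists_sq_sub_two_mul_sq_of_sub_three_mem_pow_three` / `…_of_add_three_mem_pow_three`
  (`ε ∓ 3 ∈ 𝔭³` ⟹ no `a, b, c ∈ R`, `c ≠ 0`, `a² − 2b² = c²ε`) and the field forms `forall_sq_sub_two_mul_sq_ne_of_sub_three_mem_pow_three` /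
  `…_of_add_three_mem_pow_three` (`x² − 2y² ≠ ε` for `x, y` in any fraction field `K` of `R`: `ε ∉ N(K(√2)ˣ)`).
* `e = 2` (`2 ∈ 𝔭² ∖ 𝔭³`): `not_exists_sq_sub_mul_sq_of_sub_one_mem_pow_four` (`θ ∈ 𝔭 ∖ 𝔭²`, `ε − 1 ∈ 𝔭⁴ ∖ 𝔭⁵` ⟹ no
  `a² − θb² = c²ε`) and the field form `forall_sq_sub_mul_sq_ne_of_sub_one_mem_pow_four` (`x² − θy² ≠ ε`: `ε ∉ N(K(√θ)ˣ)`; for the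
  layer `F₁(√(2+√2))/F₁`, `F₁ = F(√2)`, take `θ = 2 + √2`, of `𝔭`-order `1` at every dyadic `𝔭` of `F₁` above an unramified prime of `F`).

HONEST SCOPE: elementary local algebra (O'Meara §63, Serre Ch. II–III for `ℚ₂`) transported by localisation; only the «non-norm»
direction; nothing specific to any summit; BSD is not advanced by this file.

## References

* O. T. O'Meara, *Introduction to Quadratic Forms* (1963), §63A (63:1, squares of dyadic units), §63B (63:10, norms from `K(√m)`). [Omeara1963]
* J.-P. Serre, *A Course in Arithmetic* (1973), Ch. II §3.3, Ch. III §1.2 Thm. 1 (the model case `ℚ₂`). [Serre1973CourseArithmetic]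
* J. Neukirch, *Algebraic Number Theory* (1999), Ch. I §11 (localisation at a prime of a Dedekind domain is a DVR), Ch. V §3. [NeukirchANT1999]
-/

namespace Literature.NumberTheory.NumberFields

open IsLocalRing

variable {R : Type*} [CommRing R]

/-! ## §1 Residue field `𝔽₂` -/

/-- If `R/𝔭` has exactly two elements then every `r ∈ R` is `≡ 0` or `≡ 1 (mod 𝔭)` — the `f(𝔭|2) = 1` hypothesis («the residue
class field of a dyadic prime of degree one is `𝔽₂`») in the form the dyadic lemmas consume.
[cite: Omeara1963, §63A (residue class field at a dyadic spot; the case `N𝔭 = 2`)] -/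
theorem forall_mem_or_sub_one_mem_of_card_quotient_eq_two (P : Ideal R) (hcard : Nat.card (R ⧸ P) = 2) (r : R) :
    r ∈ P ∨ r - 1 ∈ P := by
  classical
  haveI : Finite (R ⧸ P) := Nat.finite_of_card_ne_zero (by rw [hcard]; norm_num)
  -- `0 ≠ 1` in `R ⧸ P` (else the quotient is trivial, of cardinality `1`)
  have h01 : (0 : R ⧸ P) ≠ 1 := by
    intro h
    haveI : Subsingleton (R ⧸ P) := subsingleton_of_zero_eq_one h
    have : Nat.card (R ⧸ P) = 1 := Nat.card_of_subsingleton (0 : R ⧸ P) |>.trans rfl |> fun h' => by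
      rw [Nat.card_unique]
    omega
  -- a two-element type: every element is `0` or `1`
  have hall : ∀ q : R ⧸ P, q = 0 ∨ q = 1 := by
    intro q
    by_cases hq0 : q = 0
    · exact Or.inl hq0
    by_cases hq1 : q = 1
    · exact Or.inr hq1
    exfalso
    have h3 : 3 ≤ Nat.card (R ⧸ P) := by
      have hinj : Function.Injective (![(0 : R ⧸ P), 1, q] : Fin 3 → R ⧸ P) := by
        intro i j hij
        fin_cases i <;> fin_cases j <;> simp_all [eq_comm]
      simpa using Nat.card_le_card_of_injective _ hinj
    omega
  rcases hall (Ideal.Quotient.mk P r) with h | h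
  · exact Or.inl (Ideal.Quotient.eq_zero_iff_mem.mp h)
  · right
    rw [← Ideal.Quotient.eq_zero_iff_mem, map_sub, map_one, h, sub_self]

/-! ## §2 Transport to the localisation `R_𝔭` -/

section Transfer

variable [IsDedekindDomain R] (P : Ideal R) [P.IsMaximal]

/-- **The localisation package at a non-zero prime of a Dedekind domain with residue field `𝔽₂`.**  `R_𝔭` is a discrete valuation
ring; a uniformiser `ϖ` is a prime element, every `t ∈ R_𝔭` is `≡ 0` or `≡ 1 (mod ϖ)` (write `t = r/s` with `s ∉ 𝔭`, so `s ≡ 1`), and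
for `r ∈ R`: `r ∈ 𝔭ⁿ ⟺ ϖⁿ ∣ r` in `R_𝔭` (Mathlib `IsLocalization.AtPrime.under_maximalIdeal_pow`).
[cite: NeukirchANT1999, Ch. I §11 (Prop. 11.5: localisation at a prime of a Dedekind domain is a DVR)] -/
theorem exists_prime_uniformizer_localizationAtPrime (hP0 : P ≠ ⊥) (hres : ∀ r : R, r ∈ P ∨ r - 1 ∈ P) :
    ∃ ϖ : Localization.AtPrime P, Prime ϖ ∧
      (∀ t : Localization.AtPrime P, ϖ ∣ t ∨ ϖ ∣ t - 1) ∧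
      ∀ (r : R) (n : ℕ), r ∈ P ^ n ↔ ϖ ^ n ∣ algebraMap R (Localization.AtPrime P) r := by
  haveI : IsDiscreteValuationRing (Localization.AtPrime P) :=
    IsLocalization.AtPrime.isDiscreteValuationRing_of_dedekind_domain R hP0 _
  obtain ⟨ϖ, hϖ⟩ := IsDiscreteValuationRing.exists_irreducible (Localization.AtPrime P)
  have hmax : maximalIdeal (Localization.AtPrime P) = Ideal.span {ϖ} :=
    (IsDiscreteValuationRing.irreducible_iff_uniformizer ϖ).mp hϖ
  have hprime : Prime ϖ := by
    rw [← Ideal.span_singleton_prime hϖ.ne_zero, ← hmax]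
    exact (maximalIdeal.isMaximal _).isPrime
  -- `r ∈ 𝔭ⁿ ⟺ ϖⁿ ∣ r`
  have hmem : ∀ (r : R) (n : ℕ), r ∈ P ^ n ↔ ϖ ^ n ∣ algebraMap R (Localization.AtPrime P) r := by
    intro r n
    rw [← IsLocalization.AtPrime.under_maximalIdeal_pow P (Localization.AtPrime P) n, Ideal.mem_comap, hmax,
      Ideal.span_singleton_pow, Ideal.mem_span_singleton]
  refine ⟨ϖ, hprime, fun t => ?_, hmem⟩
  -- residues: `t = r / s`, `s ∉ 𝔭` so `s ≡ 1`
  obtain ⟨⟨r, s⟩, rfl⟩ := IsLocalization.mk'_surjective P.primeCompl t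
  have hs : (s : R) ∉ P := s.2
  have hs1 : (s : R) - 1 ∈ P := (hres s).resolve_left hs
  have hunit : IsUnit (algebraMap R (Localization.AtPrime P) s) := IsLocalization.map_units _ s
  have hspec : IsLocalization.mk' (Localization.AtPrime P) r s * algebraMap R _ (s : R) = algebraMap R _ r :=
    IsLocalization.mk'_spec _ r s
  rcases hres r with hr | hr
  · left
    have h1 : ϖ ^ 1 ∣ algebraMap R (Localization.AtPrime P) r := (hmem r 1).mp (by rwa [pow_one])
    rw [pow_one, ← hspec] at h1
    exact (hunit.dvd_mul_right).mp h1
  · right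
    have hrs : r - s ∈ P ^ 1 := by
      rw [pow_one]
      have : r - (s : R) = (r - 1) - ((s : R) - 1) := by ring
      rw [this]
      exact P.sub_mem hr hs1
    have h1 := (hmem _ 1).mp hrs
    rw [pow_one, map_sub, ← hspec, ← sub_one_mul] at h1
    exact (hunit.dvd_mul_right).mp h1

/-- Transport of `a² − m b² = c²ε` (`c ≠ 0`) from `R` to `R_𝔭` (injectivity of `R → R_𝔭` for a domain). [folklore] -/
private theorem exists_sq_sub_mul_sq_localization {m ε : R} (h : ∃ a b c : R, c ≠ 0 ∧ a ^ 2 - m * b ^ 2 = c ^ 2 * ε) :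
    ∃ a b c : Localization.AtPrime P, c ≠ 0 ∧
      a ^ 2 - algebraMap R _ m * b ^ 2 = c ^ 2 * algebraMap R _ ε := by
  obtain ⟨a, b, c, hc, h⟩ := h
  refine ⟨algebraMap R _ a, algebraMap R _ b, algebraMap R _ c, ?_, ?_⟩
  · exact fun h0 => hc (IsLocalization.injective (Localization.AtPrime P) P.primeCompl_le_nonZeroDivisors
      (by rw [h0, map_zero]))
  · have := congrArg (algebraMap R (Localization.AtPrime P)) h
    simpa only [map_sub, map_mul, map_pow] using this

end Transfer

/-! ## §3 Clearing denominators -/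

section Field

variable [IsDomain R] (K : Type*) [Field K] [Algebra R K] [IsFractionRing R K]

/-- Clearing denominators: `x² − m y² = ε` in a fraction field `K` of `R` gives `a² − m b² = c²ε` in `R` with `c ≠ 0`. [folklore] -/
private theorem exists_sq_sub_mul_sq_of_field' {m ε : R} {x y : K}
    (h : x ^ 2 - algebraMap R K m * y ^ 2 = algebraMap R K ε) :
    ∃ a b c : R, c ≠ 0 ∧ a ^ 2 - m * b ^ 2 = c ^ 2 * ε := by
  obtain ⟨a₁, d₁, hd₁, hx⟩ := IsFractionRing.div_surjective (A := R) x
  obtain ⟨a₂, d₂, hd₂, hy⟩ := IsFractionRing.div_surjective (A := R) y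
  have hd₁0 : d₁ ≠ 0 := nonZeroDivisors.ne_zero hd₁
  have hd₂0 : d₂ ≠ 0 := nonZeroDivisors.ne_zero hd₂
  have hd₁K : algebraMap R K d₁ ≠ 0 := IsFractionRing.to_map_ne_zero_of_mem_nonZeroDivisors hd₁
  have hd₂K : algebraMap R K d₂ ≠ 0 := IsFractionRing.to_map_ne_zero_of_mem_nonZeroDivisors hd₂
  refine ⟨a₁ * d₂, a₂ * d₁, d₁ * d₂, mul_ne_zero hd₁0 hd₂0, ?_⟩
  have hx' : algebraMap R K a₁ = x * algebraMap R K d₁ := by rw [← hx, div_mul_cancel₀ _ hd₁K]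
  have hy' : algebraMap R K a₂ = y * algebraMap R K d₂ := by rw [← hy, div_mul_cancel₀ _ hd₂K]
  apply IsFractionRing.injective R K
  simp only [map_sub, map_mul, map_pow]
  rw [hx', hy']
  linear_combination (algebraMap R K d₁ * algebraMap R K d₂) ^ 2 * h

end Field

/-! ## §4 `e = 1`, `f = 1`: `ε ≡ ±3 (mod 𝔭³)` is not `x² − 2y²` -/

section Unramified

variable [IsDedekindDomain R] (P : Ideal R) [P.IsMaximal]

/-- **`ε ≡ 3 (mod 𝔭³)` is not `a² − 2b²` up to squares, at a dyadic prime IDEAL with `e = f = 1`.**  `R` a Dedekind domain, `𝔭 ≠ 0`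
maximal with `R/𝔭 = 𝔽₂`, `2 ∈ 𝔭 ∖ 𝔭²`, `ε − 3 ∈ 𝔭³`: there are no `a, b, c ∈ R`, `c ≠ 0`, with `a² − 2b² = c²ε`.  (In `R_𝔭`:
`2 = ϖw`, `ϖ ∤ w`, `ϖ³ ∣ ε − 3`, and `DyadicUnitNotNormFromSqrtTwo`'s `not_exists_sq_sub_two_mul_sq_of_pow_three_dvd_sub_three`.)
«`(ε, 2)_𝔭 = −1` for `ε ≡ 3 (mod 8)`», no principality of `𝔭` needed. [cite: Serre1973CourseArithmetic, Ch. III §1.2, Thm. 1]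
[cite: Omeara1963, §63B (63:10)] -/
theorem not_exists_sq_sub_two_mul_sq_of_sub_three_mem_pow_three (hP0 : P ≠ ⊥) (hres : ∀ r : R, r ∈ P ∨ r - 1 ∈ P)
    (h2 : (2 : R) ∈ P) (h2' : (2 : R) ∉ P ^ 2) {ε : R} (h3 : ε - 3 ∈ P ^ 3) :
    ¬ ∃ a b c : R, c ≠ 0 ∧ a ^ 2 - 2 * b ^ 2 = c ^ 2 * ε := by
  intro h
  haveI : IsDiscreteValuationRing (Localization.AtPrime P) :=
    IsLocalization.AtPrime.isDiscreteValuationRing_of_dedekind_domain R hP0 _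
  obtain ⟨ϖ, hϖ, hresS, hmem⟩ := exists_prime_uniformizer_localizationAtPrime P hP0 hres
  -- `2 = ϖ w`, `ϖ ∤ w`
  obtain ⟨w, hw⟩ : ϖ ^ 1 ∣ algebraMap R (Localization.AtPrime P) 2 := (hmem 2 1).mp (by rwa [pow_one])
  rw [pow_one, map_ofNat] at hw
  have hwndvd : ¬ ϖ ∣ w := by
    rintro ⟨w', rfl⟩
    apply h2'
    rw [hmem, map_ofNat, hw]
    exact ⟨w', by ring⟩
  -- `ϖ³ ∣ ε − 3`
  have h3S : ϖ ^ 3 ∣ algebraMap R (Localization.AtPrime P) ε - 3 := by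
    have := (hmem _ 3).mp h3
    rwa [map_sub, map_ofNat] at this
  obtain ⟨a, b, c, hc, habc⟩ := exists_sq_sub_mul_sq_localization P h
  rw [map_ofNat] at habc
  exact not_exists_sq_sub_two_mul_sq_of_pow_three_dvd_sub_three hϖ hw hwndvd hresS h3S ⟨a, b, c, hc, habc⟩

/-- **`ε ≡ −3 (mod 𝔭³)` is not `a² − 2b²` up to squares, at a dyadic prime ideal with `e = f = 1`** («`(ε, 2)_𝔭 = −1` for
`ε ≡ 5 (mod 8)`»). [cite: Serre1973CourseArithmetic, Ch. III §1.2, Thm. 1] [cite: Omeara1963, §63B (63:10)] -/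
theorem not_exists_sq_sub_two_mul_sq_of_add_three_mem_pow_three (hP0 : P ≠ ⊥) (hres : ∀ r : R, r ∈ P ∨ r - 1 ∈ P)
    (h2 : (2 : R) ∈ P) (h2' : (2 : R) ∉ P ^ 2) {ε : R} (h3 : ε + 3 ∈ P ^ 3) :
    ¬ ∃ a b c : R, c ≠ 0 ∧ a ^ 2 - 2 * b ^ 2 = c ^ 2 * ε := by
  intro h
  haveI : IsDiscreteValuationRing (Localization.AtPrime P) :=
    IsLocalization.AtPrime.isDiscreteValuationRing_of_dedekind_domain R hP0 _
  obtain ⟨ϖ, hϖ, hresS, hmem⟩ := exists_prime_uniformizer_localizationAtPrime P hP0 hres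
  obtain ⟨w, hw⟩ : ϖ ^ 1 ∣ algebraMap R (Localization.AtPrime P) 2 := (hmem 2 1).mp (by rwa [pow_one])
  rw [pow_one, map_ofNat] at hw
  have hwndvd : ¬ ϖ ∣ w := by
    rintro ⟨w', rfl⟩
    apply h2'
    rw [hmem, map_ofNat, hw]
    exact ⟨w', by ring⟩
  have h3S : ϖ ^ 3 ∣ algebraMap R (Localization.AtPrime P) ε + 3 := by
    have := (hmem _ 3).mp h3
    rwa [map_add, map_ofNat] at this
  obtain ⟨a, b, c, hc, habc⟩ := exists_sq_sub_mul_sq_localization P h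
  rw [map_ofNat] at habc
  exact not_exists_sq_sub_two_mul_sq_of_pow_three_dvd_add_three hϖ hw hwndvd hresS h3S ⟨a, b, c, hc, habc⟩

variable (K : Type*) [Field K] [Algebra R K] [IsFractionRing R K]

/-- **Field form, `e = f = 1`: `ε ≡ 3 (mod 𝔭³)` is not `x² − 2y²` with `x, y` in the fraction field** — `ε ∉ N(K(√2)ˣ)`
(O'Meara 63:10), at any dyadic prime ideal `𝔭` of `R` with `e = f = 1`, principal or not.
[cite: Serre1973CourseArithmetic, Ch. III §1.2, Thm. 1] [cite: Omeara1963, §63B (63:10)] -/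
theorem forall_sq_sub_two_mul_sq_ne_of_sub_three_mem_pow_three (hP0 : P ≠ ⊥) (hres : ∀ r : R, r ∈ P ∨ r - 1 ∈ P)
    (h2 : (2 : R) ∈ P) (h2' : (2 : R) ∉ P ^ 2) {ε : R} (h3 : ε - 3 ∈ P ^ 3) (x y : K) :
    x ^ 2 - 2 * y ^ 2 ≠ algebraMap R K ε := by
  intro h
  have h' : x ^ 2 - algebraMap R K 2 * y ^ 2 = algebraMap R K ε := by rwa [map_ofNat]
  exact not_exists_sq_sub_two_mul_sq_of_sub_three_mem_pow_three P hP0 hres h2 h2' h3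
    (exists_sq_sub_mul_sq_of_field' K h')

/-- **Field form, `e = f = 1`, `ε ≡ −3 (mod 𝔭³)`**: `x² − 2y² ≠ ε` for `x, y ∈ K`. [cite: Serre1973CourseArithmetic, Ch. III §1.2, Thm. 1]
[cite: Omeara1963, §63B (63:10)] -/
theorem forall_sq_sub_two_mul_sq_ne_of_add_three_mem_pow_three (hP0 : P ≠ ⊥) (hres : ∀ r : R, r ∈ P ∨ r - 1 ∈ P)
    (h2 : (2 : R) ∈ P) (h2' : (2 : R) ∉ P ^ 2) {ε : R} (h3 : ε + 3 ∈ P ^ 3) (x y : K) :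
    x ^ 2 - 2 * y ^ 2 ≠ algebraMap R K ε := by
  intro h
  have h' : x ^ 2 - algebraMap R K 2 * y ^ 2 = algebraMap R K ε := by rwa [map_ofNat]
  exact not_exists_sq_sub_two_mul_sq_of_add_three_mem_pow_three P hP0 hres h2 h2' h3
    (exists_sq_sub_mul_sq_of_field' K h')

end Unramified

/-! ## §5 `e = 2`, `f = 1`: `ε ≡ 1 (mod 𝔭⁴)`, `≢ 1 (mod 𝔭⁵)` is not `x² − θy²` for `𝔭 ‖ θ` -/

section Ramified

variable [IsDedekindDomain R] (P : Ideal R) [P.IsMaximal]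

/-- **`π⁴ ‖ ε − 1` at a dyadic prime IDEAL with `e = 2`, `f = 1`: `ε` is not `a² − θb²` up to squares for `𝔭 ‖ θ`.**  `R` a
Dedekind domain, `𝔭 ≠ 0` maximal with `R/𝔭 = 𝔽₂`, `2 ∈ 𝔭² ∖ 𝔭³`, `θ ∈ 𝔭 ∖ 𝔭²`, `ε − 1 ∈ 𝔭⁴ ∖ 𝔭⁵`: there are no `a, b, c ∈ R`, `c ≠ 0`,
with `a² − θb² = c²ε`.  (In `R_𝔭`: `2 = ϖ²w`, `θ = ϖμ` with `ϖ ∤ w, μ`, `ϖ⁴ ‖ ε − 1`, and `DyadicUnitSquaresRamifiedPrime`'s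
`not_exists_sq_sub_mul_sq_of_pow_four_dvd`.)  «`(ε, θ)_𝔭 = −1` for `ε ≡ 1 + ϖ⁴ (mod ϖ⁵)`»; no principality of `𝔭` needed.
[cite: Omeara1963, §63B (63:10) and §63A (63:1)] [cite: NeukirchANT1999, Ch. V §3] -/
theorem not_exists_sq_sub_mul_sq_of_sub_one_mem_pow_four (hP0 : P ≠ ⊥) (hres : ∀ r : R, r ∈ P ∨ r - 1 ∈ P)
    (h2 : (2 : R) ∈ P ^ 2) (h2' : (2 : R) ∉ P ^ 3) {θ : R} (hθ : θ ∈ P) (hθ' : θ ∉ P ^ 2) {ε : R}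
    (h4 : ε - 1 ∈ P ^ 4) (h5 : ε - 1 ∉ P ^ 5) :
    ¬ ∃ a b c : R, c ≠ 0 ∧ a ^ 2 - θ * b ^ 2 = c ^ 2 * ε := by
  intro h
  haveI : IsDiscreteValuationRing (Localization.AtPrime P) :=
    IsLocalization.AtPrime.isDiscreteValuationRing_of_dedekind_domain R hP0 _
  obtain ⟨ϖ, hϖ, hresS, hmem⟩ := exists_prime_uniformizer_localizationAtPrime P hP0 hres
  -- `2 = ϖ² w`, `ϖ ∤ w`
  obtain ⟨w, hw⟩ : ϖ ^ 2 ∣ algebraMap R (Localization.AtPrime P) 2 := (hmem 2 2).mp h2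
  rw [map_ofNat] at hw
  have hwndvd : ¬ ϖ ∣ w := by
    rintro ⟨w', rfl⟩
    apply h2'
    rw [hmem, map_ofNat, hw]
    exact ⟨w', by ring⟩
  -- `θ = ϖ μ`, `ϖ ∤ μ`
  obtain ⟨μ, hμ⟩ : ϖ ^ 1 ∣ algebraMap R (Localization.AtPrime P) θ := (hmem θ 1).mp (by rwa [pow_one])
  rw [pow_one] at hμ
  have hμndvd : ¬ ϖ ∣ μ := by
    rintro ⟨μ', rfl⟩
    apply hθ'
    rw [hmem, hμ]
    exact ⟨μ', by ring⟩
  -- `ϖ⁴ ‖ ε − 1`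
  have h4S : ϖ ^ 4 ∣ algebraMap R (Localization.AtPrime P) ε - 1 := by
    have := (hmem _ 4).mp h4
    rwa [map_sub, map_one] at this
  have h5S : ¬ ϖ ^ 5 ∣ algebraMap R (Localization.AtPrime P) ε - 1 := by
    intro hd
    apply h5
    rw [hmem, map_sub, map_one]
    exact hd
  obtain ⟨a, b, c, hc, habc⟩ := exists_sq_sub_mul_sq_localization P h
  rw [hμ] at habc
  exact not_exists_sq_sub_mul_sq_of_pow_four_dvd hϖ hw hwndvd hresS hμndvd h4S h5S ⟨a, b, c, hc, habc⟩

variable (K : Type*) [Field K] [Algebra R K] [IsFractionRing R K]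

/-- **Field form, `e = 2`, `f = 1`: `ε` with `ε − 1 ∈ 𝔭⁴ ∖ 𝔭⁵` is not `x² − θy²` (`θ ∈ 𝔭 ∖ 𝔭²`) with `x, y` in the fraction field** —
`ε ∉ N(K(√θ)ˣ)` (O'Meara 63:10); for the layer `F₁(√(2+√2))/F₁` of the cyclotomic `ℤ₂`-tower of a field `F` in which `2` is
unramified, `F₁ = F(√2)`, take `θ = 2 + √2` at any dyadic prime `𝔭` of `F₁`. [cite: Omeara1963, §63B (63:10) and §63A (63:1)]
[cite: NeukirchANT1999, Ch. V §3] -/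
theorem forall_sq_sub_mul_sq_ne_of_sub_one_mem_pow_four (hP0 : P ≠ ⊥) (hres : ∀ r : R, r ∈ P ∨ r - 1 ∈ P)
    (h2 : (2 : R) ∈ P ^ 2) (h2' : (2 : R) ∉ P ^ 3) {θ : R} (hθ : θ ∈ P) (hθ' : θ ∉ P ^ 2) {ε : R}
    (h4 : ε - 1 ∈ P ^ 4) (h5 : ε - 1 ∉ P ^ 5) (x y : K) :
    x ^ 2 - algebraMap R K θ * y ^ 2 ≠ algebraMap R K ε := fun h =>
  not_exists_sq_sub_mul_sq_of_sub_one_mem_pow_four P hP0 hres h2 h2' hθ hθ' h4 h5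
    (exists_sq_sub_mul_sq_of_field' K h)

end Ramified

end Literature.NumberTheory.NumberFields
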